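import Literature.ComputerArithmetic.Shewchuk1997.TwoDiff
import Literature.ComputerArithmetic.Shewchuk1997.ScaleExpansion
import Mathlib.Tactic.Linarith
import Mathlib.Tactic.Positivity
import Mathlib.Tactic.Ring
import Mathlib.Tactic.NormNum

/-!
# Shewchuk (1997), §2.8: distillation, products of expansions, comparison

J. R. Shewchuk, *Adaptive precision floating-point arithmetic and fast robust geometric
predicates*, Discrete Comput. Geom. 18 (1997) 305–363 [Shewchuk1997], §2.8 "Other Operations",
pp. 333–334 — the three composite operations built from the toolkit of §2.4–2.7, which the earlier
files of this directory list as NOT TYPED (`ExpansionArithmetic.lean` §2.1–2.4 with EXPANSION-SUM,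
`FastExpansionSum.lean`, `ScaleExpansion.lean` §2.5–2.6 with SCALE-EXPANSION, `Compress.lean` §2.7,
`TwoDiff.lean` §2.3/§2.8 with the sign and zero tests).  As printed:

> (p. 333) Distillation is the process of summing `k` unordered `p`-bit values. Distillation can be
> performed by the divide-and-conquer algorithm of Priest [23], which uses any expansion addition
> algorithm to sum the values in a tree-like fashion as illustrated in Fig. 16. Each `p`-bit addend
> is a leaf of the tree, and each interior node represents a call to an expansion addition
> algorithm. If EXPANSION-SUM is used (and zero elimination is not), then it does not matter
> whether the tree is balanced; distillation will take precisely `½k(k − 1)` TWO-SUM operations,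
> regardless of the order in which expansions are combined. If FAST-EXPANSION-SUM is used, the
> speed of distillation depends strongly on the balance of the tree. A well-balanced tree will
> yield an `O(k log k)` distillation algorithm, an asymptotic improvement over distilling with
> EXPANSION-SUM. [...]
> To find the product of two expansions `e` and `f`, use SCALE-EXPANSION (with zero elimination)
> to form the expansions `ef₁, ef₂, …`, then sum these using a distillation tree.
> (p. 334) Division cannot always, of course, be performed exactly, but it can be performed to
> arbitrary precision by an iterative algorithm [...] Consult Priest [23] for one such algorithm.
> The easiest way to compare two expansions is to subtract one from the other, and test the sign
> of the result. An expansion's sign can be easily tested because of the nonoverlapping property;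
> simply check the sign of the expansion's most significant nonzero component.

MODEL / DICTIONARY (as in `ExpansionArithmetic.lean`).  Floats are `JeannerodRump2018.IsFloat p
emin` over `ℚ` (precision `p`, gradual underflow, no overflow); `fl` is ANY round-to-nearest map
`IsRoundNearest p emin fl`, "round-to-even" is `roundTiesEven p emin`.  Expansions are `List ℚ`
from the SMALLEST component; "nonoverlapping (increasing except zeros)" is `IsExpansion 1`,
"nonadjacent" is `IsExpansion 2`.  A DISTILLATION TREE (Fig. 16) is the inductive `DistillTree`
(leaves = the addend expansions — a `p`-bit value `x` is the one-component expansion `[x]` —, each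
interior node a call to the expansion addition algorithm `add`), evaluated by `DistillTree.distill
add`; the "divide-and-conquer" balanced tree over a list of addends is `DistillTree.balanced`, and
distillation of `k` values with EXPANSION-SUM is `distillValues fl`.  The number of TWO-SUM
operations is the cost model `DistillTree.twoSumCount`: EXPANSION-SUM of an `m`- and an
`n`-component expansion performs `n` GROW-EXPANSIONs of `m` TWO-SUMs each (Theorem 12: every window
has `m` components and no zero is eliminated), i.e. `mn` operations, and returns `m + n` components.
The product recipe is `expansionProduct tp fl e f` (SCALE-EXPANSION of `e` by each `fᵢ`, then the
balanced distillation tree with EXPANSION-SUM; `tp` is the exact two-product of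
`ScaleExpansion.lean`), WITHOUT zero elimination.  Comparison is `expansionDiff fl e f`
(EXPANSION-SUM of `e` and the componentwise negation of `f`) followed by `lastNonzero`, the most
significant nonzero component.

PROVED HERE (0 named facts, 0 sorry).
* DISTILLATION IS CORRECT FOR ANY TREE and any addition algorithm that maps two expansions of a
  class to an expansion of the class with the exact sum (`DistillTree.distill_induction`,
  `DistillTree.sum_distill`, `DistillTree.length_distill`, `DistillTree.length_distill_of`);
  instances: EXPANSION-SUM for ANY tie rule on nonoverlapping leaves
  (`distill_expansionSum_nonoverlapping`: nonoverlapping, exact sum, all components kept, floats)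
  and with round-to-even on nonadjacent leaves
  (`distill_expansionSum_nonadjacent`); `k` `p`-bit values (`distillValues_nonoverlapping`).
* "PRECISELY `½k(k − 1)` TWO-SUM OPERATIONS, REGARDLESS OF THE ORDER": for every tree,
  `2·twoSumCount + Σ (leaf lengths)² = (Σ leaf lengths)²` (`DistillTree.two_mul_twoSumCount_add`),
  hence `twoSumCount = k(k − 1)/2` for `k` one-component leaves, whatever the tree
  (`DistillTree.twoSumCount_eq_choose_two`, `twoSumCount_balanced_values`).
* PRODUCT: `expansionProduct_spec` — under the hypotheses of Theorem 19 for each `fᵢ` (exact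
  two-product, the no-underflow format condition of `ScaleExpansion.lean`), the result is a
  nonoverlapping expansion of `2mn` floats with sum `(Σ e)(Σ f)`, for ANY tie rule (generic form
  over the leaf guarantees `expansionProduct_spec_of_leaves`; round-to-even / nonadjacent
  `expansionProduct_nonadjacent`; the FMA two-product instance `expansionProduct_twoProdFMA_spec`).
* COMPARISON: `negateExpansion` preserves expansions (`isExpansion_negateExpansion`);
  `expansionDiff_nonoverlapping` (nonoverlapping, sum `Σ e − Σ f`); the most significant nonzero
  component carries the sign of an expansion (`sign_lastNonzero`, from `TwoDiff.lean`'s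
  `sum_pos_iff_of_isExpansion`); hence `compareExpansions_spec`: the sign of
  `lastNonzero (expansionDiff fl e f)` is the sign of `Σ e − Σ f`.

NOT TYPED: the running-time claims (`O(k log k)`, "usually fastest to use an unrolled
EXPANSION-SUM to create expansions of length four"); distillation with FAST-EXPANSION-SUM (its
proved guarantee, `fastExpansionSum_nonoverlapping`, asks for strongly nonoverlapping inputs and
yields a nonoverlapping output, so it does not compose through a tree on its own — see the ERRATUM
in `FastExpansionSum.lean`; the generic theorem applies to any class an addition algorithm does
preserve); zero elimination; division (Priest [23]); Fig. 16 beyond the balanced-tree builder.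
-/

namespace Literature.ComputerArithmetic.Shewchuk1997

open Literature.ComputerArithmetic.JeannerodRump2018
open Literature.ComputerArithmetic.BoldoJeannerodMelquiondMuller2023 hiding twoSum

variable {p : ℕ} {emin : ℤ} {fl : ℚ → ℚ}

/-! ### Distillation trees -/

/-- A DISTILLATION TREE (Fig. 16): "Each `p`-bit addend is a leaf of the tree, and each interior
node represents a call to an expansion addition algorithm" — leaves hold the addends as expansions
(a `p`-bit value `x` is the one-component expansion `[x]`).
[cite: Shewchuk1997, §2.8 p. 333 (Fig. 16 p. 334)] -/
inductive DistillTree : Type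
  | leaf : List ℚ → DistillTree
  | node : DistillTree → DistillTree → DistillTree

namespace DistillTree

/-- The addends at the leaves, from left to right. [cite: Shewchuk1997, §2.8 p. 333] -/
def leaves : DistillTree → List (List ℚ)
  | leaf e => [e]
  | node l r => l.leaves ++ r.leaves

/-- The total number of components below a node (= the number of components of the expansion
computed there when no zero is eliminated). [cite: Shewchuk1997, §2.8 p. 333] -/
def width : DistillTree → ℕ
  | leaf e => e.length
  | node l r => l.width + r.width

/-- DISTILLATION: evaluate the tree, calling the expansion addition algorithm `add` at every
interior node ("uses any expansion addition algorithm to sum the values in a tree-like fashion").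
[cite: Shewchuk1997, §2.8 p. 333] -/
def distill (add : List ℚ → List ℚ → List ℚ) : DistillTree → List ℚ
  | leaf e => e
  | node l r => add (l.distill add) (r.distill add)

/-- THE COST MODEL: the number of TWO-SUM operations when EXPANSION-SUM (without zero elimination)
is the addition algorithm — an `m`-component and an `n`-component expansion cost `mn` TWO-SUMs
(`n` GROW-EXPANSIONs of `m` TWO-SUMs, Theorems 10 and 12) and give `m + n` components.
[cite: Shewchuk1997, §2.8 p. 333; Thm 12 p. 318] -/
def twoSumCount : DistillTree → ℕ
  | leaf _ => 0
  | node l r => l.twoSumCount + r.twoSumCount + l.width * r.width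

/-- A leaf is one addend. [cite: Shewchuk1997, §2.8 p. 333] -/
@[simp] theorem leaves_leaf (e : List ℚ) : (leaf e).leaves = [e] := rfl
/-- The addends of a node are those of its subtrees. [cite: Shewchuk1997, §2.8 p. 333] -/
@[simp] theorem leaves_node (l r : DistillTree) : (node l r).leaves = l.leaves ++ r.leaves := rfl
/-- The width of a leaf is its number of components. [cite: Shewchuk1997, §2.8 p. 333] -/
@[simp] theorem width_leaf (e : List ℚ) : (leaf e).width = e.length := rfl
/-- The width of a node: `m + n` components. [cite: Shewchuk1997, §2.8 p. 333] -/
@[simp] theorem width_node (l r : DistillTree) : (node l r).width = l.width + r.width := rfl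
/-- A leaf evaluates to its addend. [cite: Shewchuk1997, §2.8 p. 333] -/
@[simp] theorem distill_leaf (add : List ℚ → List ℚ → List ℚ) (e : List ℚ) :
    (leaf e).distill add = e := rfl
/-- "each interior node represents a call to an expansion addition algorithm".
[cite: Shewchuk1997, §2.8 p. 333] -/
@[simp] theorem distill_node (add : List ℚ → List ℚ → List ℚ) (l r : DistillTree) :
    (node l r).distill add = add (l.distill add) (r.distill add) := rfl
/-- A leaf costs no TWO-SUM. [cite: Shewchuk1997, §2.8 p. 333] -/
@[simp] theorem twoSumCount_leaf (e : List ℚ) : (leaf e).twoSumCount = 0 := rfl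
/-- A node costs its subtrees plus `mn` TWO-SUMs for the EXPANSION-SUM call.
[cite: Shewchuk1997, §2.8 p. 333; Thm 12 p. 318] -/
@[simp] theorem twoSumCount_node (l r : DistillTree) :
    (node l r).twoSumCount = l.twoSumCount + r.twoSumCount + l.width * r.width := rfl

/-- The width is the total length of the leaves. [cite: Shewchuk1997, §2.8 p. 333] -/
theorem width_eq_sum_length : ∀ t : DistillTree, t.width = (t.leaves.map List.length).sum
  | leaf e => by simp
  | node l r => by simp [width_eq_sum_length l, width_eq_sum_length r]

/-- **"REGARDLESS OF THE ORDER IN WHICH EXPANSIONS ARE COMBINED"**: for every distillation tree,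
twice the number of TWO-SUM operations plus the sum of the squared leaf lengths is the square of
the total length — the count depends only on the multiset of leaf lengths, not on the tree.
[cite: Shewchuk1997, §2.8 p. 333] -/
theorem two_mul_twoSumCount_add :
    ∀ t : DistillTree, 2 * t.twoSumCount + (t.leaves.map fun e => e.length ^ 2).sum = t.width ^ 2
  | leaf e => by simp
  | node l r => by
    have hl := two_mul_twoSumCount_add l
    have hr := two_mul_twoSumCount_add r
    simp only [twoSumCount_node, leaves_node, List.map_append, List.sum_append, width_node]
    nlinarith [hl, hr]

/-- **"DISTILLATION WILL TAKE PRECISELY `½k(k − 1)` TWO-SUM OPERATIONS"** (EXPANSION-SUM, no zero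
elimination, `k` `p`-bit addends = one-component leaves), whatever the shape of the tree.
[cite: Shewchuk1997, §2.8 p. 333] -/
theorem twoSumCount_eq_choose_two (t : DistillTree) (h : ∀ e ∈ t.leaves, e.length = 1) :
    t.twoSumCount = t.leaves.length.choose 2 := by
  have hsq : (t.leaves.map fun e => e.length ^ 2).sum = t.leaves.length := by
    have : (t.leaves.map fun e => e.length ^ 2) = t.leaves.map fun _ => 1 :=
      List.map_congr_left fun e he => by rw [h e he, one_pow]
    rw [this, List.map_const', List.sum_replicate, smul_eq_mul, mul_one]
  have hw : t.width = t.leaves.length := by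
    rw [width_eq_sum_length]
    have : (t.leaves.map List.length) = t.leaves.map fun _ => 1 :=
      List.map_congr_left fun e he => by rw [h e he]
    rw [this, List.map_const', List.sum_replicate, smul_eq_mul, mul_one]
  have key := two_mul_twoSumCount_add t
  rw [hsq, hw] at key
  have hc := Nat.choose_two_right t.leaves.length
  -- `2·count + k = k²`, `choose k 2 = k(k−1)/2`
  rcases Nat.eq_zero_or_pos t.leaves.length with hk | hk
  · rw [hk] at key ⊢; simp at key ⊢; omega
  · have h2 : 2 * t.twoSumCount = t.leaves.length * (t.leaves.length - 1) := by
      have : t.leaves.length ^ 2 = t.leaves.length * (t.leaves.length - 1) + t.leaves.length := by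
        cases hn : t.leaves.length with
        | zero => omega
        | succ n => rw [pow_two, Nat.succ_sub_one]; ring
      omega
    rw [hc]
    omega

/-- **DISTILLATION IS CORRECT FOR ANY TREE**, for any class of expansions the addition algorithm
preserves. [cite: Shewchuk1997, §2.8 p. 333] -/
theorem distill_induction {P : List ℚ → Prop} {add : List ℚ → List ℚ → List ℚ}
    (hadd : ∀ e f, P e → P f → P (add e f)) :
    ∀ t : DistillTree, (∀ e ∈ t.leaves, P e) → P (t.distill add)
  | leaf e, h => by simpa using h
  | node l r, h => by
    rw [distill_node]
    exact hadd _ _ (distill_induction hadd l fun e he => h e (by simp [he]))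
      (distill_induction hadd r fun e he => h e (by simp [he]))

/-- The distilled expansion has the sum of all the addends, if the addition algorithm sums
exactly on the preserved class. [cite: Shewchuk1997, §2.8 p. 333] -/
theorem sum_distill {P : List ℚ → Prop} {add : List ℚ → List ℚ → List ℚ}
    (hadd : ∀ e f, P e → P f → P (add e f))
    (hsum : ∀ e f, P e → P f → (add e f).sum = e.sum + f.sum) :
    ∀ t : DistillTree, (∀ e ∈ t.leaves, P e) → (t.distill add).sum = (t.leaves.map List.sum).sum
  | leaf e, _ => by simp
  | node l r, h => by
    have hl : ∀ e ∈ l.leaves, P e := fun e he => h e (by simp [he])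
    have hr : ∀ e ∈ r.leaves, P e := fun e he => h e (by simp [he])
    rw [distill_node, hsum _ _ (distill_induction hadd l hl) (distill_induction hadd r hr),
      sum_distill hadd hsum l hl, sum_distill hadd hsum r hr]
    simp

/-- Without zero elimination every component is kept: the distilled expansion has `width`
components. [cite: Shewchuk1997, §2.8 p. 333] -/
theorem length_distill {add : List ℚ → List ℚ → List ℚ}
    (hlen : ∀ e f, (add e f).length = e.length + f.length) :
    ∀ t : DistillTree, (t.distill add).length = t.width
  | leaf e => rfl
  | node l r => by rw [distill_node, hlen, length_distill hlen l, length_distill hlen r, width_node]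

/-- The component count relative to a preserved class: if the addition algorithm keeps every
component on the class `P`, the distilled expansion has `width` components.
[cite: Shewchuk1997, §2.8 p. 333] -/
theorem length_distill_of {P : List ℚ → Prop} {add : List ℚ → List ℚ → List ℚ}
    (hadd : ∀ e f, P e → P f → P (add e f))
    (hlen : ∀ e f, P e → P f → (add e f).length = e.length + f.length) :
    ∀ t : DistillTree, (∀ e ∈ t.leaves, P e) → (t.distill add).length = t.width
  | leaf e, _ => rfl
  | node l r, h => by
    have hl : ∀ e ∈ l.leaves, P e := fun e he => h e (by simp [he])
    have hr : ∀ e ∈ r.leaves, P e := fun e he => h e (by simp [he])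
    rw [distill_node, hlen _ _ (distill_induction hadd l hl) (distill_induction hadd r hr),
      length_distill_of hadd hlen l hl, length_distill_of hadd hlen r hr, width_node]

/-- THE DIVIDE-AND-CONQUER TREE over a list of addends (Priest's algorithm, Fig. 16): split the
list into two halves and recurse (an empty list gives the empty expansion).
[cite: Shewchuk1997, §2.8 p. 333 (Fig. 16 p. 334)] -/
def balanced : List (List ℚ) → DistillTree
  | [] => leaf []
  | [e] => leaf e
  | e₁ :: e₂ :: es =>
    node (balanced ((e₁ :: e₂ :: es).take ((es.length + 2) / 2)))
      (balanced ((e₁ :: e₂ :: es).drop ((es.length + 2) / 2)))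
termination_by l => l.length
decreasing_by
  all_goals simp only [List.length_take, List.length_drop, List.length_cons]; omega

/-- The balanced tree over a nonempty list of addends has exactly these leaves, in order.
[cite: Shewchuk1997, §2.8 p. 333 (Fig. 16 p. 334)] -/
theorem leaves_balanced : ∀ l : List (List ℚ), l ≠ [] → (balanced l).leaves = l
  | [], h => absurd rfl h
  | [e], _ => by rw [balanced]; rfl
  | e₁ :: e₂ :: es, _ => by
    rw [balanced, leaves_node, leaves_balanced, leaves_balanced, List.take_append_drop]
    · intro h
      have := congrArg List.length h
      simp only [List.length_drop, List.length_cons, List.length_nil] at this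
      omega
    · intro h
      have := congrArg List.length h
      simp only [List.length_take, List.length_cons, List.length_nil] at this
      omega
termination_by l => l.length
decreasing_by
  all_goals simp only [List.length_take, List.length_drop, List.length_cons]; omega

/-- The balanced tree over the empty list is the empty leaf. [cite: Shewchuk1997, §2.8 p. 333] -/
@[simp] theorem balanced_nil : balanced [] = leaf [] := by rw [balanced]

end DistillTree

/-! ### Distillation with EXPANSION-SUM (Theorem 12) -/

/-- **DISTILLATION WITH EXPANSION-SUM, ANY TIE RULE, ANY TREE**: if every leaf is a nonoverlapping
expansion of floats (in particular a single `p`-bit value), the distilled result is a nonoverlapping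
expansion of floats whose sum is the sum of the addends and which keeps every component.
[cite: Shewchuk1997, §2.8 p. 333; Thm 12 p. 318] -/
theorem distill_expansionSum_nonoverlapping (hp : 1 ≤ p) (hfl : IsRoundNearest p emin fl)
    (t : DistillTree) (hF : ∀ e ∈ t.leaves, ∀ x ∈ e, IsFloat p emin x)
    (hE : ∀ e ∈ t.leaves, IsExpansion 1 e) :
    IsExpansion 1 (t.distill (expansionSum fl)) ∧
      (t.distill (expansionSum fl)).sum = (t.leaves.map List.sum).sum ∧
      (t.distill (expansionSum fl)).length = t.width ∧
      ∀ x ∈ t.distill (expansionSum fl), IsFloat p emin x := by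
  let P : List ℚ → Prop := fun e => (∀ x ∈ e, IsFloat p emin x) ∧ IsExpansion 1 e
  have hadd : ∀ e f, P e → P f → P (expansionSum fl e f) := fun e f he hf =>
    ⟨isFloat_of_mem_expansionSum hfl he.1 hf.1,
      isExpansion_expansionSum hp hfl zero_le_one (roundoffBelow_one hp hfl) he.1 hf.1 he.2 hf.2⟩
  have hsum : ∀ e f, P e → P f → (expansionSum fl e f).sum = e.sum + f.sum := fun e f he hf =>
    sum_expansionSum hp hfl he.1 hf.1
  have hl : ∀ e ∈ t.leaves, P e := fun e he => ⟨hF e he, hE e he⟩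
  have hP := DistillTree.distill_induction hadd t hl
  exact ⟨hP.2, DistillTree.sum_distill hadd hsum t hl,
    DistillTree.length_distill (length_expansionSum fl) t, hP.1⟩

/-- DISTILLATION WITH EXPANSION-SUM AND ROUND-TO-EVEN on nonadjacent leaves gives a nonadjacent
expansion (Theorem 12, "Furthermore ..."). [cite: Shewchuk1997, §2.8 p. 333; Thm 12 p. 318] -/
theorem distill_expansionSum_nonadjacent (hp : 1 ≤ p) (t : DistillTree)
    (hF : ∀ e ∈ t.leaves, ∀ x ∈ e, IsFloat p emin x) (hE : ∀ e ∈ t.leaves, IsExpansion 2 e) :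
    IsExpansion 2 (t.distill (expansionSum (roundTiesEven p emin))) ∧
      (t.distill (expansionSum (roundTiesEven p emin))).sum = (t.leaves.map List.sum).sum := by
  have hfl := isRoundNearest_roundTiesEven (emin := emin) hp
  let P : List ℚ → Prop := fun e => (∀ x ∈ e, IsFloat p emin x) ∧ IsExpansion 2 e
  have hadd : ∀ e f, P e → P f → P (expansionSum (roundTiesEven p emin) e f) := fun e f he hf =>
    ⟨isFloat_of_mem_expansionSum hfl he.1 hf.1, isExpansion_expansionSum hp hfl zero_le_two
      (roundoffBelow_two_roundTiesEven p emin) he.1 hf.1 he.2 hf.2⟩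
  have hsum : ∀ e f, P e → P f → (expansionSum (roundTiesEven p emin) e f).sum = e.sum + f.sum :=
    fun e f he hf => sum_expansionSum hp hfl he.1 hf.1
  have hl : ∀ e ∈ t.leaves, P e := fun e he => ⟨hF e he, hE e he⟩
  exact ⟨(DistillTree.distill_induction hadd t hl).2, DistillTree.sum_distill hadd hsum t hl⟩

/-- **DISTILLATION OF `k` `p`-BIT VALUES** (Fig. 16): the balanced tree whose leaves are the values,
evaluated with EXPANSION-SUM. [cite: Shewchuk1997, §2.8 p. 333 (Fig. 16 p. 334)] -/
def distillValues (fl : ℚ → ℚ) (xs : List ℚ) : List ℚ :=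
  (DistillTree.balanced (xs.map fun x => [x])).distill (expansionSum fl)

/-- The leaves of the tree of `distillValues`. [cite: Shewchuk1997, §2.8 p. 333] -/
theorem leaves_balanced_values (xs : List ℚ) (hxs : xs ≠ []) :
    (DistillTree.balanced (xs.map fun x => [x])).leaves = xs.map fun x => [x] :=
  DistillTree.leaves_balanced _ (by simpa using hxs)

/-- **DISTILLATION SUMS `k` UNORDERED `p`-BIT VALUES INTO A NONOVERLAPPING EXPANSION**, for ANY
tie rule: `k` components (no zero elimination), floats, exact sum.
[cite: Shewchuk1997, §2.8 p. 333] -/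
theorem distillValues_nonoverlapping (hp : 1 ≤ p) (hfl : IsRoundNearest p emin fl) {xs : List ℚ}
    (hxs : ∀ x ∈ xs, IsFloat p emin x) :
    IsExpansion 1 (distillValues fl xs) ∧ (distillValues fl xs).sum = xs.sum ∧
      (distillValues fl xs).length = xs.length ∧ ∀ x ∈ distillValues fl xs, IsFloat p emin x := by
  unfold distillValues
  by_cases h0 : xs = []
  · subst h0
    simp [isExpansion_nil]
  · have hl := leaves_balanced_values xs h0
    obtain ⟨hE, hS, hL, hF⟩ := distill_expansionSum_nonoverlapping hp hfl
      (DistillTree.balanced (xs.map fun x => [x]))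
      (fun e he => by
        rw [hl] at he
        obtain ⟨x, hx, rfl⟩ := List.mem_map.mp he
        simpa using hxs x hx)
      (fun e he => by
        rw [hl] at he
        obtain ⟨x, hx, rfl⟩ := List.mem_map.mp he
        exact isExpansion_singleton 1 x)
    refine ⟨hE, ?_, ?_, hF⟩
    · rw [hS, hl, List.map_map]
      have : (List.sum ∘ fun x : ℚ => [x]) = id := by funext x; simp
      rw [this, List.map_id]
    · rw [hL, DistillTree.width_eq_sum_length, hl, List.map_map]
      have : ((List.length ∘ fun x : ℚ => [x]) : ℚ → ℕ) = fun _ => 1 := by funext x; simp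
      rw [this, List.map_const', List.sum_replicate, smul_eq_mul, mul_one]

/-- **`½k(k − 1)` TWO-SUMS FOR `k` VALUES** (EXPANSION-SUM, the balanced tree — or any other).
[cite: Shewchuk1997, §2.8 p. 333] -/
theorem twoSumCount_balanced_values (xs : List ℚ) :
    (DistillTree.balanced (xs.map fun x => [x])).twoSumCount = xs.length.choose 2 := by
  by_cases h0 : xs = []
  · subst h0; simp
  · rw [DistillTree.twoSumCount_eq_choose_two _ (fun e he => by
      rw [leaves_balanced_values xs h0] at he
      obtain ⟨x, _, rfl⟩ := List.mem_map.mp he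
      rfl), leaves_balanced_values xs h0, List.length_map]

/-! ### Products of expansions -/

/-- **THE PRODUCT OF TWO EXPANSIONS**: "use SCALE-EXPANSION [...] to form the expansions
`ef₁, ef₂, …`, then sum these using a distillation tree" (here: the balanced tree with
EXPANSION-SUM, no zero elimination; `tp` is the exact two-product used by SCALE-EXPANSION).
[cite: Shewchuk1997, §2.8 p. 333] -/
def expansionProduct (tp : ℚ → ℚ → ℚ × ℚ) (fl : ℚ → ℚ) (e f : List ℚ) : List ℚ :=
  (DistillTree.balanced (f.map fun b => scaleExpansion tp fl e b)).distill (expansionSum fl)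

/-- The leaves of the product's distillation tree: one SCALE-EXPANSION per component of `f`.
[cite: Shewchuk1997, §2.8 p. 333] -/
theorem leaves_balanced_scaleExpansion (tp : ℚ → ℚ → ℚ × ℚ) (fl : ℚ → ℚ) (e : List ℚ)
    {f : List ℚ} (hf : f ≠ []) :
    (DistillTree.balanced (f.map fun b => scaleExpansion tp fl e b)).leaves =
      f.map fun b => scaleExpansion tp fl e b :=
  DistillTree.leaves_balanced _ (by simpa using hf)

/-- THE PRODUCT RECIPE, GENERIC FORM: if every `e·fᵢ` computed by SCALE-EXPANSION is an expansion of
the class `IsExpansion c` of floats with sum `(Σ e)·fᵢ` and `2m` components, and EXPANSION-SUM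
preserves that class (Theorem 12: `c = 1` for any tie rule, `c = 2` with round-to-even), then the
distilled product is such an expansion with sum `(Σ e)(Σ f)` and `2mn` components (no zero
elimination). [cite: Shewchuk1997, §2.8 p. 333; Thm 12 p. 318; Thm 19 p. 328] -/
theorem expansionProduct_spec_of_leaves (hp : 1 ≤ p) (hfl : IsRoundNearest p emin fl) {c : ℚ}
    (hc : 0 ≤ c) (hflc : RoundoffBelow c fl) {tp : ℚ → ℚ → ℚ × ℚ} {e f : List ℚ}
    (hleaf : ∀ b ∈ f, IsExpansion c (scaleExpansion tp fl e b) ∧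
      (scaleExpansion tp fl e b).sum = e.sum * b ∧
      (∀ z ∈ scaleExpansion tp fl e b, IsFloat p emin z) ∧
      (scaleExpansion tp fl e b).length = 2 * e.length) :
    IsExpansion c (expansionProduct tp fl e f) ∧
      (expansionProduct tp fl e f).sum = e.sum * f.sum ∧
      (∀ z ∈ expansionProduct tp fl e f, IsFloat p emin z) ∧
      (expansionProduct tp fl e f).length = 2 * e.length * f.length := by
  unfold expansionProduct
  by_cases h0 : f = []
  · subst h0
    simp [isExpansion_nil]
  · have hl := leaves_balanced_scaleExpansion tp fl e h0
    set t := DistillTree.balanced (f.map fun b => scaleExpansion tp fl e b) with ht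
    let P : List ℚ → Prop := fun l => (∀ x ∈ l, IsFloat p emin x) ∧ IsExpansion c l
    have hadd : ∀ l l', P l → P l' → P (expansionSum fl l l') := fun l l' hl₁ hl₂ =>
      ⟨isFloat_of_mem_expansionSum hfl hl₁.1 hl₂.1,
        isExpansion_expansionSum hp hfl hc hflc hl₁.1 hl₂.1 hl₁.2 hl₂.2⟩
    have hsum : ∀ l l', P l → P l' → (expansionSum fl l l').sum = l.sum + l'.sum :=
      fun l l' hl₁ hl₂ => sum_expansionSum hp hfl hl₁.1 hl₂.1
    have hP : ∀ l ∈ t.leaves, P l := by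
      intro l hl'
      rw [hl] at hl'
      obtain ⟨b, hb, rfl⟩ := List.mem_map.mp hl'
      exact ⟨(hleaf b hb).2.2.1, (hleaf b hb).1⟩
    have hind := DistillTree.distill_induction hadd t hP
    refine ⟨hind.2, ?_, hind.1, ?_⟩
    · rw [DistillTree.sum_distill hadd hsum t hP, hl, List.map_map]
      have : (f.map (List.sum ∘ fun b => scaleExpansion tp fl e b)) = f.map fun b => e.sum * b :=
        List.map_congr_left fun b hb => by simpa using (hleaf b hb).2.1
      rw [this, List.sum_map_mul_left, List.map_id']
    · rw [DistillTree.length_distill (length_expansionSum fl) t, DistillTree.width_eq_sum_length,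
        hl, List.map_map]
      have : (f.map (List.length ∘ fun b => scaleExpansion tp fl e b)) =
          f.map fun _ => 2 * e.length :=
        List.map_congr_left fun b hb => by simpa using (hleaf b hb).2.2.2
      rw [this, List.map_const', List.sum_replicate, smul_eq_mul]
      ring

/-- **THE PRODUCT RECIPE IS CORRECT** (any tie rule): if `e` is a nonoverlapping expansion of
floats and every component `fᵢ` of `f` satisfies the hypotheses of Theorem 19 (a `p`-bit value
`fᵢ = Mᵢ·2^kᵢ`, the components of `e` representable `p`-bit numbers above `2^(emin − kᵢ)`, and the
two-product exact on `e × fᵢ`), then `expansionProduct` is a nonoverlapping expansion of `2mn`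
floats with sum `(Σ e)(Σ f)`. [cite: Shewchuk1997, §2.8 p. 333; Thm 19 p. 328] -/
theorem expansionProduct_spec (hp : 1 ≤ p) (hfl : IsRoundNearest p emin fl) {tp : ℚ → ℚ → ℚ × ℚ}
    {e f : List ℚ} (he : ∀ x ∈ e, IsFloat p emin x) (hexp : IsExpansion 1 e)
    (hf : ∀ b ∈ f, ∃ Mb kb : ℤ, b = (Mb : ℚ) * 2 ^ kb ∧ |Mb| < (2 : ℤ) ^ p ∧
      ∀ x ∈ e, IsFloat p (emin - kb) x)
    (htp : ∀ b ∈ f, ∀ x ∈ e, (tp x b).1 = fl (x * b) ∧ (tp x b).1 + (tp x b).2 = x * b) :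
    IsExpansion 1 (expansionProduct tp fl e f) ∧
      (expansionProduct tp fl e f).sum = e.sum * f.sum ∧
      (∀ z ∈ expansionProduct tp fl e f, IsFloat p emin z) ∧
      (expansionProduct tp fl e f).length = 2 * e.length * f.length :=
  expansionProduct_spec_of_leaves hp hfl zero_le_one (roundoffBelow_one hp hfl) fun b hb => by
    obtain ⟨Mb, kb, hbrep, hMb, heU⟩ := hf b hb
    exact scaleExpansion_nonoverlapping hp hfl hbrep (by exact_mod_cast hMb) he heU hexp (htp b hb)

/-- **THE PRODUCT RECIPE WITH ROUND-TO-EVEN**: a nonadjacent `e` gives a nonadjacent product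
(Theorems 12 and 19, "Furthermore ..." clauses). [cite: Shewchuk1997, §2.8 p. 333; Thm 19 p. 328] -/
theorem expansionProduct_nonadjacent (hp : 1 ≤ p) {tp : ℚ → ℚ → ℚ × ℚ} {e f : List ℚ}
    (he : ∀ x ∈ e, IsFloat p emin x) (hexp : IsExpansion 2 e)
    (hf : ∀ b ∈ f, ∃ Mb kb : ℤ, b = (Mb : ℚ) * 2 ^ kb ∧ |Mb| < (2 : ℤ) ^ p ∧
      ∀ x ∈ e, IsFloat p (emin - kb) x)
    (htp : ∀ b ∈ f, ∀ x ∈ e, (tp x b).1 = roundTiesEven p emin (x * b) ∧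
      (tp x b).1 + (tp x b).2 = x * b) :
    IsExpansion 2 (expansionProduct tp (roundTiesEven p emin) e f) ∧
      (expansionProduct tp (roundTiesEven p emin) e f).sum = e.sum * f.sum ∧
      (∀ z ∈ expansionProduct tp (roundTiesEven p emin) e f, IsFloat p emin z) ∧
      (expansionProduct tp (roundTiesEven p emin) e f).length = 2 * e.length * f.length :=
  expansionProduct_spec_of_leaves hp (isRoundNearest_roundTiesEven hp) zero_le_two
    (roundoffBelow_two_roundTiesEven p emin) fun b hb => by
    obtain ⟨Mb, kb, hbrep, hMb, heU⟩ := hf b hb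
    exact scaleExpansion_nonadjacent hp hbrep (by exact_mod_cast hMb) he heU hexp (htp b hb)

/-- **THE PRODUCT RECIPE WITH THE FMA TWO-PRODUCT** (`twoProdFMA` of
[BoldoJeannerodMelquiondMuller2023], exact in the no-underflow model): nonoverlapping, exact,
`2mn` floats, any tie rule. [cite: Shewchuk1997, §2.8 p. 333; Thm 19 p. 328] -/
theorem expansionProduct_twoProdFMA_spec (hp : 1 ≤ p) (hfl : IsRoundNearest p emin fl)
    {e f : List ℚ} (he : ∀ x ∈ e, IsFloat p emin x) (hexp : IsExpansion 1 e)
    (hf : ∀ b ∈ f, ∃ Mb kb : ℤ, b = (Mb : ℚ) * 2 ^ kb ∧ |Mb| < (2 : ℤ) ^ p ∧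
      ∀ x ∈ e, IsFloat p (emin - kb) x) :
    IsExpansion 1 (expansionProduct (twoProdFMA fl) fl e f) ∧
      (expansionProduct (twoProdFMA fl) fl e f).sum = e.sum * f.sum ∧
      (∀ z ∈ expansionProduct (twoProdFMA fl) fl e f, IsFloat p emin z) ∧
      (expansionProduct (twoProdFMA fl) fl e f).length = 2 * e.length * f.length :=
  expansionProduct_spec hp hfl he hexp hf fun b hb x hx => by
    obtain ⟨Mb, kb, hbrep, hMb, heU⟩ := hf b hb
    exact twoProdFMA_exact_of_rep hp hfl hbrep (by exact_mod_cast hMb) (heU x hx)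

/-! ### Comparison of expansions -/

/-- The componentwise negation of an expansion. [cite: Shewchuk1997, §2.8 p. 334] -/
def negateExpansion (e : List ℚ) : List ℚ := e.map fun x => -x

/-- Negation of the empty expansion. [cite: Shewchuk1997, §2.8 p. 334] -/
@[simp] theorem negateExpansion_nil : negateExpansion [] = [] := rfl
/-- Negation, componentwise. [cite: Shewchuk1997, §2.8 p. 334] -/
@[simp] theorem negateExpansion_cons (x : ℚ) (xs : List ℚ) :
    negateExpansion (x :: xs) = -x :: negateExpansion xs := rfl

/-- Negation preserves (non)overlapping and (non)adjacency: `Below c` is invariant under sign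
changes. [cite: Shewchuk1997, §2.8 p. 334; §2.1 p. 309] -/
theorem Below.neg {c x y : ℚ} (h : Below c x y) : Below c (-x) (-y) := by
  obtain ⟨s, hs, hlt⟩ := h
  exact ⟨s, hs.neg, by rwa [abs_neg]⟩

/-- The negation of an expansion is an expansion of the same kind.
[cite: Shewchuk1997, §2.8 p. 334] -/
theorem isExpansion_negateExpansion {c : ℚ} {e : List ℚ} (h : IsExpansion c e) :
    IsExpansion c (negateExpansion e) := by
  unfold negateExpansion IsExpansion
  rw [List.pairwise_map]
  exact h.imp fun hab => hab.neg

/-- The negation has the negated sum. [cite: Shewchuk1997, §2.8 p. 334] -/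
theorem sum_negateExpansion (e : List ℚ) : (negateExpansion e).sum = -e.sum := by
  unfold negateExpansion
  induction e with
  | nil => simp
  | cons x xs ih => simp [List.sum_cons, ih]; ring

/-- The negation has as many components. [cite: Shewchuk1997, §2.8 p. 334] -/
theorem length_negateExpansion (e : List ℚ) : (negateExpansion e).length = e.length :=
  List.length_map _

/-- The components of the negation are floats. [cite: Shewchuk1997, §2.8 p. 334] -/
theorem isFloat_of_mem_negateExpansion {e : List ℚ} (he : ∀ x ∈ e, IsFloat p emin x) :
    ∀ x ∈ negateExpansion e, IsFloat p emin x := by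
  intro x hx
  obtain ⟨y, hy, rfl⟩ := List.mem_map.mp hx
  exact (he y hy).neg

/-- "SUBTRACT ONE FROM THE OTHER": the difference of two expansions, by EXPANSION-SUM of `e` and
the negation of `f`. [cite: Shewchuk1997, §2.8 p. 334] -/
def expansionDiff (fl : ℚ → ℚ) (e f : List ℚ) : List ℚ := expansionSum fl e (negateExpansion f)

/-- The difference is a nonoverlapping expansion of floats with sum `Σ e − Σ f`, for ANY tie rule.
[cite: Shewchuk1997, §2.8 p. 334; Thm 12 p. 318] -/
theorem expansionDiff_nonoverlapping (hp : 1 ≤ p) (hfl : IsRoundNearest p emin fl) {e f : List ℚ}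
    (he : ∀ x ∈ e, IsFloat p emin x) (hf : ∀ x ∈ f, IsFloat p emin x) (hee : IsExpansion 1 e)
    (hff : IsExpansion 1 f) :
    IsExpansion 1 (expansionDiff fl e f) ∧ (expansionDiff fl e f).sum = e.sum - f.sum ∧
      (expansionDiff fl e f).length = e.length + f.length ∧
      ∀ x ∈ expansionDiff fl e f, IsFloat p emin x := by
  obtain ⟨hE, hS, hL, hF⟩ := expansionSum_nonoverlapping hp hfl he
    (isFloat_of_mem_negateExpansion hf) hee (isExpansion_negateExpansion hff)
  refine ⟨hE, ?_, ?_, hF⟩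
  · rw [expansionDiff, hS, sum_negateExpansion]; ring
  · rw [expansionDiff, hL, length_negateExpansion]

/-- THE MOST SIGNIFICANT NONZERO COMPONENT of an expansion (listed from the smallest component), or
`0` if every component is zero. [cite: Shewchuk1997, §2.8 p. 334] -/
def lastNonzero : List ℚ → ℚ
  | [] => 0
  | x :: xs => if lastNonzero xs = 0 then x else lastNonzero xs

/-- The empty expansion has no nonzero component. [cite: Shewchuk1997, §2.8 p. 334] -/
@[simp] theorem lastNonzero_nil : lastNonzero [] = 0 := rfl
/-- The defining recursion: the most significant nonzero component of the tail if there is one,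
else the head. [cite: Shewchuk1997, §2.8 p. 334] -/
theorem lastNonzero_cons (x : ℚ) (xs : List ℚ) :
    lastNonzero (x :: xs) = if lastNonzero xs = 0 then x else lastNonzero xs := rfl

/-- Appending a nonzero component makes it the most significant nonzero one.
[cite: Shewchuk1997, §2.8 p. 334] -/
theorem lastNonzero_append_of_ne_zero (l : List ℚ) {t : ℚ} (ht : t ≠ 0) :
    lastNonzero (l ++ [t]) = t := by
  induction l with
  | nil => simp [lastNonzero_cons]
  | cons x xs ih => rw [List.cons_append, lastNonzero_cons, ih, if_neg ht]

/-- Appending a zero component changes nothing. [cite: Shewchuk1997, §2.8 p. 334] -/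
theorem lastNonzero_append_zero (l : List ℚ) : lastNonzero (l ++ [0]) = lastNonzero l := by
  induction l with
  | nil => simp [lastNonzero_cons]
  | cons x xs ih => rw [List.cons_append, lastNonzero_cons, ih, lastNonzero_cons]

/-- **THE SIGN TEST**: "An expansion's sign can be easily tested because of the nonoverlapping
property; simply check the sign of the expansion's most significant nonzero component" — for a
nonoverlapping increasing-except-zeros expansion of floats, the sum is positive, negative or zero
exactly when the most significant nonzero component (or `0`) is.
[cite: Shewchuk1997, §2.8 p. 334] -/
theorem sign_lastNonzero {l : List ℚ} (hl : ∀ x ∈ l, IsFloat p emin x) (hexp : IsExpansion 1 l) :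
    (0 < l.sum ↔ 0 < lastNonzero l) ∧ (l.sum < 0 ↔ lastNonzero l < 0) ∧
      (l.sum = 0 ↔ lastNonzero l = 0) := by
  induction l using List.reverseRecOn with
  | nil => simp
  | append_singleton l t ih =>
    have hlF : ∀ x ∈ l, IsFloat p emin x := fun x hx => hl x (List.mem_append_left _ hx)
    have htF : IsFloat p emin t := hl t (by simp)
    have hexp' : IsExpansion 1 l := (List.pairwise_append.mp hexp).1
    by_cases ht0 : t = 0
    · subst ht0
      rw [lastNonzero_append_zero, List.sum_append, List.sum_singleton, add_zero]
      exact ih hlF hexp'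
    · rw [lastNonzero_append_of_ne_zero l ht0]
      obtain ⟨h1, h2⟩ := sum_pos_iff_of_isExpansion hlF htF ht0 hexp
      refine ⟨h1, h2, ⟨fun h0 => ?_, fun h => absurd h ht0⟩⟩
      exfalso
      rcases lt_or_gt_of_ne ht0 with hlt | hgt
      · have := h2.mpr hlt; rw [h0] at this; exact lt_irrefl _ this
      · have := h1.mpr hgt; rw [h0] at this; exact lt_irrefl _ this

/-- "THE EASIEST WAY TO COMPARE TWO EXPANSIONS is to subtract one from the other, and test the sign
of the result": the comparison key, the most significant nonzero component of the difference.
[cite: Shewchuk1997, §2.8 p. 334] -/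
def compareExpansions (fl : ℚ → ℚ) (e f : List ℚ) : ℚ := lastNonzero (expansionDiff fl e f)

/-- **COMPARISON IS CORRECT** (any tie rule): the key is positive iff `Σ f < Σ e`, negative iff
`Σ e < Σ f`, zero iff the expansions have equal values. [cite: Shewchuk1997, §2.8 p. 334] -/
theorem compareExpansions_spec (hp : 1 ≤ p) (hfl : IsRoundNearest p emin fl) {e f : List ℚ}
    (he : ∀ x ∈ e, IsFloat p emin x) (hf : ∀ x ∈ f, IsFloat p emin x) (hee : IsExpansion 1 e)
    (hff : IsExpansion 1 f) :
    (0 < compareExpansions fl e f ↔ f.sum < e.sum) ∧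
      (compareExpansions fl e f < 0 ↔ e.sum < f.sum) ∧
      (compareExpansions fl e f = 0 ↔ e.sum = f.sum) := by
  obtain ⟨hE, hS, -, hF⟩ := expansionDiff_nonoverlapping hp hfl he hf hee hff
  obtain ⟨h1, h2, h3⟩ := sign_lastNonzero hF hE
  rw [hS] at h1 h2 h3
  unfold compareExpansions
  refine ⟨?_, ?_, ?_⟩
  · rw [← h1]; constructor <;> intro h <;> linarith
  · rw [← h2]; constructor <;> intro h <;> linarith
  · rw [← h3]; constructor <;> intro h <;> linarith

end Literature.ComputerArithmetic.Shewchuk1997
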